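import Literature.AlgebraicGeometry.Resolution.PointBlowupMohBound
import HarnessLib

/-!
# Moh's stability theorem at order `p` in every dimension: along any sequence of point blow-ups
  the shade never exceeds its running minimum by more than one

Topic: `Literature/AlgebraicGeometry/Resolution`. Reproduction (cell `pub-hironaka`, unit
`b2b-hironaka-cp4`, DIM-4 CENSUS gen 12; sequel of `PointBlowupMohBound.lean`, which proves the
ONE-blow-up half `MohBound p 1` and "no two consecutive increases") of the SEQUENCE half of

* T. T. Moh, *On a stability theorem for local uniformization in characteristic `p`*,
  Publ. RIMS Kyoto Univ. **23** (1987) 965–973 [Moh1987], "The Stability Theorem" (Introduction,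
  p. 966): for `z^{pᵉ} + ∏ xᵢ^{mᵢ} F(x₁,…,x_n) = 0` in ANY number `n` of variables, "After a
  permissible blowup, along a residually rational valuation `v` of the function field, say factor
  out `x₁` and let `F = x₁ᵈF̄`. Then `ord F̄ ≤ d + p^{e−1}` and successive permissible blow-ups
  will not increase `ord F̄` beyond the bound `d + p^{e−1}` … until it drops to `d` or less";
  proof §1, pp. 967–973, whose last page argues the sequence statement from the "Statement"
  (p. 972): after an increase `F` "has a term `A` with (i) `ord A ≤ d + pʳ` (ii) `ord_{x_s} A = c`
  … `p^{r+1} ∤ c`", "The interesting thing is that now `x_s` is an `X`-kind of variable due to the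
  fact that `m_s` becomes zero", and the two cases "(1) `v(x_s)` is the only minimal. … we have to
  factor out `x_s` and do it without any translation. Due to the existence of the term `A`, the
  order of `F` will drop at least by `c`" / "(2) `v(x_s)` is not the only minimal. … by factoring
  out `x_i` (which is not `x_s`) and then translating … the order of `F` will not increase",
  "Repeating the above argument, we establish that `d + pʳ` is the upper bound for orders for all
  successive blow-ups until the order becomes less than or equal to `d`" (p. 973) — here for
  `e = 1` (so `r = 0`, `p ∤ c`) and POINT blow-ups;
* H. Hauser, S. Perlega, *Cycles of singularities appearing in the resolution problem in positive
  characteristic*, J. Algebraic Geom. **28** (2019) = arXiv:1802.05010 [HauserPerlega2019], §3: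
  "Moh claimed in [Moh] that the following Stability Theorem holds: Let be given a purely
  inseparable equation `f = z^{pᵉ} + F(x₁,…,x_n) = 0` with residual order `d` and a sequence of
  permissible blowups under which the order of the transforms of `f` remain constant. Then the
  residual orders of the transforms of `f` cannot increase beyond the bound `d + p^{e−1}`. …
  This disproves Moh's claim in the case `e ≥ 3` (it is known to be valid for `e = 1`)" — the
  tree has the refutation for `e = 3` (`Literature.Barriers.ResolutionOfSingularities.
  mohStabilityClaim_false`); THIS FILE PROVES THE `e = 1` CASE for point blow-ups, in every
  dimension, at arbitrary (not valuation-prescribed) points;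
* H. Hauser, Bull. AMS **47** (2010) [Hauser2010], §F p. 16: "He then briefly investigates the
  case where an increase of the shade indeed occurs, showing that in the next blowup the shade has
  to drop at least by 1 (if `e = 1`). This, obviously, does not suffice yet to make induction
  work." (Point-wise the sharp statement is "does not increase": the `z`-origin above Hauser's
  kangaroo point STALLS, `PointBlowupKangaroo.shadeStalls_kangaroo_origin`.)

## What is proved (every field `K` of characteristic `p`, every finite index type `σ` of
## residual variables `y` — hypersurfaces `x^p + F(y) = 0` of EVERY dimension —, the
## `State`/`step`/`shade` semantics of `PointBlowupShade.lean`)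

Call MOH'S WITNESS of a state `(F, r)` a NON-exceptional variable `y_{i₀}` (`r_{i₀} = 0`) that
occurs in some initial monomial `y^{d₀}` of `F` (`|d₀| = ord₀ F`) with an exponent prime to `p`
(Moh's `x_s` with the term `A`, `ord_{x_s} A = c`, `p ∤ c`). For states with `y^r ∣ F`
monomialwise and `ord₀ F ≥ p`, and ANY point `b` of the `y_j`-chart (`b_j = 0`):

* `exists_support_step_of_not_dvd_self` — **Probe 3** (new here): in the chart `j = i₀` OF the
  witness the new residual polynomial has a monomial in its lowest `y_j`-layer, surviving the
  cleaning, of degree `≤ |r′| + shade − 1`, or of degree `≤ |r′| + shade` with an exponent prime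
  to `p` at a TRANSLATED variable (`b_i ≠ 0`);
* `shade_step_add_le_of_untranslated` — Moh's case (1) verbatim: at the ORIGIN of the chart of
  the witness (`b = 0`) `shade′ + c ≤ shade`, `c = (d₀)_{i₀}` ("will drop at least by `c`");
* `shade_step_le_of_not_dvd_self`, **`shade_step_le_of_witness`**, `not_shadeIncreases_of_witness`
  — a state with Moh's witness admits NO increase of the shade under the next point blow-up, in
  ANY chart at ANY point (chart `≠ i₀`: Probe 2 of `PointBlowupMohBound`, Moh's case (2); chart
  `= i₀`: Probe 3 — the translated points of this chart are not considered in [Moh87], whose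
  Convention p. 967 makes `x_s` the last variable, so that `x_s` is factored out only when
  `v(x_s)` is the unique minimum, i.e. without translation);
* **`exists_witness_step_of_shade_eq`** — PERSISTENCE: if moreover the shade of the new state
  equals the old one (a stall), the new state again has a Moh witness (`y_{i₀}` itself in a chart
  `≠ i₀`; a translated variable in the chart `i₀`);
* **`shade_le_shade_add_one_along` — MOH'S STABILITY THEOREM FOR `e = 1`**: along ANY sequence
  `s_{n+1} = step p (j n) (b n) s_n` of point blow-ups at points of the successive exceptional
  divisors (`b n (j n) = 0`), starting from a cleaned state (`F ≠ 0`, no `p`-th power monomials,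
  `y^r ∣ F`) and staying on the equimultiple branch (`ord₀ F_n ≥ p` for all `n`):
  `shade(s_m) ≤ shade(s_n) + 1` for all `n ≤ m` — the shade never exceeds its running minimum by
  more than one; `shade_le_shade_zero_add_one_along` (`n = 0`: Hauser–Perlega's formulation
  "cannot increase beyond the bound `d + 1`"); `shade_eq_add_one_until_drop` (Moh's formulation:
  after an increase from `d` the shade EQUALS `d + 1` until it drops to `≤ d`).
  Proof: an increase creates a witness (`exists_nonexceptional_of_shadeIncreases` of
  `PointBlowupMohBound`), a witness forbids a further increase and survives stalls — induction.

## Method: the third probe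

`PointBlowupMohBound` reads the lowest `y_j`-layer of the translated chart transform
`G = translate b (chartTransform p j F)` through `G` itself (Probe 1) and through `∂G/∂y_{i₀}`,
`i₀ ≠ j` (Probe 2). Neither sees the exponent of the chart variable `y_j`, which the chart
absorbs into `|d| − p`. Probe 3 is the `j`-RELATIVE EULER OPERATOR: for any constant `c₀`,
`translate b (Σ_d (c₀ − |d| + d_j)·c_d·y^{d^}) = c₀·G − Σ_{i ≠ j} (y_i + b_i)·∂G/∂y_i`
(`translate_eulerProbe`; `Σ_{i≠j} y_i ∂_i` multiplies `y^{d^}` by `Σ_{i≠j} d_i = |d| − d_j`, and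
derivations, products and constants pass through the translation). With `c₀ = o = ord₀ F` the
lowest layer of the left-hand polynomial consists of the initial monomials with `p ∤ d_j`, of
degree `≤ |ρ| + shade − 1` when `r_j = 0` (because then `d_j ≥ 1 > r_j`), so the layer lemma
`exists_mem_support_translate_layer` produces a monomial `y^β` of degree `≤ |r′| + shade − 1`
on the right-hand side, and `transfer_eulerOperator` reads off a monomial of `G`: either `y^β`
itself with weight `o − Σ_{i≠j} β_i ≠ 0` in `K` (hence not a `p`-th power: a strict drop), or
`y^{β+e_i}` at a translated `i` with `p ∤ β_i + 1` (no increase; under a stall this monomial is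
initial and `y_i` is the new witness). No Hasse derivatives, no valuations.

## What is NOT proved here (scope, honest)

* `e = 2` (`q = p²`, bound `d + p`): the one-step bound needs Hasse derivatives ([Moh87]
  Propositions 1–2) and the sequence behaviour for `e = 2` has no printed statement either way
  that we could locate; `e ≥ 3` is false ([HP19], tree `mohStabilityClaim_false`).
* Centres of positive dimension (Moh's permissible centres `P = (y₁,…,y_s)`, Hauser–Perlega's
  `S ⊋ T`; tree `CentreBlowup` of `PointBlowupShadeCentres.lean`): only point blow-ups.
* The witness is a property of the cleaned coordinates of the model (cf. the reading note R-Moh-1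
  of the cell: over a non-perfect field the model's cleaning is stronger than Hauser's); nothing is
  claimed about intrinsic maximal-contact-free invariants, and nothing here is a statement about
  resolution of singularities — census value only (row O5 of the dimension-4 census: at
  multiplicity `p`, the multiplicity CP's dimension-3 theorem reduces to, the classical residual
  order is not only `1`-Lipschitz upward per point blow-up but BOUNDED by its running minimum
  `+ 1` along every point-blow-up sequence, in every dimension, kernel-checked).
-/

noncomputable section

open MvPolynomial Finset

open scoped BigOperators

namespace Literature.AlgebraicGeometry.Resolution

open Literature.AlgebraicGeometry.Resolution.Hauser2010
open Literature.Barriers.ResolutionOfSingularities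
open Literature.AlgebraicGeometry.Resolution.WeightedBlowup

namespace PointBlowup

/-! ## 1. The relative Euler operator `Σ_{i ≠ j} (y_i + b_i) ∂/∂y_i` -/

section Euler

variable {σ : Type*} {K : Type*} [Field K] [Fintype σ] [DecidableEq σ]

/-- `Σ_{i ≠ j} y_i ∂_i` acts on a monomial `c·y^e` as multiplication by `|e| − e_j`. [folklore] -/
theorem sum_erase_X_mul_pderiv_monomial (j : σ) (e : σ →₀ ℕ) (c : K) :
    ∑ i ∈ univ.erase j, X i * pderiv i (monomial e c) =
      monomial e (((e.degree - e j : ℕ) : K) * c) := by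
  simp_rw [X_mul_pderiv_monomial]
  rw [← Finset.sum_smul]
  have h : ∑ i ∈ univ.erase j, e i = e.degree - e j := by
    have := degree_eq_add_sum_erase j e
    omega
  rw [h, ← map_nsmul, nsmul_eq_mul]

omit [Fintype σ] [DecidableEq σ] in
/-- Translation is multiplicative against a variable: `translate b (y_i · Q) = (y_i + b_i) · translate b Q`.
[folklore] -/
theorem translate_X_mul (b : σ → K) (i : σ) (Q : MvPolynomial σ K) :
    translate b (X i * Q) = (X i + C (b i)) * translate b Q := by
  unfold translate
  rw [map_mul, aeval_X]

omit [Fintype σ] [DecidableEq σ] in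
/-- Translation commutes with constants: `translate b (C c · Q) = C c · translate b Q`. [folklore] -/
theorem translate_C_mul (b : σ → K) (c : K) (Q : MvPolynomial σ K) :
    translate b (C c * Q) = C c * translate b Q := by
  unfold translate
  rw [map_mul, algHom_C, algebraMap_eq]

omit [Fintype σ] [DecidableEq σ] in
/-- Translation is additive over finite sums. [folklore] -/
theorem translate_finset_sum {ι : Type*} (b : σ → K) (t : Finset ι) (f : ι → MvPolynomial σ K) :
    translate b (∑ x ∈ t, f x) = ∑ x ∈ t, translate b (f x) := by
  unfold translate
  rw [map_sum]

omit [Fintype σ] [DecidableEq σ] in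
/-- Translation is compatible with subtraction. [folklore] -/
theorem translate_sub (b : σ → K) (P Q : MvPolynomial σ K) :
    translate b (P - Q) = translate b P - translate b Q := by
  unfold translate
  rw [map_sub]

omit [Fintype σ] [DecidableEq σ] in
/-- Translating by the zero vector is the identity. [folklore] -/
theorem translate_eq_self (b : σ → K) (hb : ∀ i, b i = 0) (P : MvPolynomial σ K) :
    translate b P = P := by
  unfold translate
  have h : (fun i => (X i + C (b i) : MvPolynomial σ K)) = X := by
    funext i
    rw [hb i, C_0, add_zero]
  rw [h, MvPolynomial.aeval_X_left, AlgHom.id_apply]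

omit [Fintype σ] in
/-- `coeff_β (y_i · ∂_i G) = β_i · coeff_β G`. [folklore] -/
theorem coeff_X_mul_pderiv (i : σ) (G : MvPolynomial σ K) (β : σ →₀ ℕ) :
    coeff β (X i * pderiv i G) = (β i : K) * coeff β G := by
  induction G using MvPolynomial.induction_on' with
  | monomial e c =>
    rw [X_mul_pderiv_monomial, ← map_nsmul, nsmul_eq_mul, coeff_monomial, coeff_monomial]
    by_cases h : e = β
    · subst h; rw [if_pos rfl, if_pos rfl]
    · rw [if_neg h, if_neg h, mul_zero]
  | add f g hf hg => rw [Derivation.map_add, mul_add, coeff_add, coeff_add, hf, hg, mul_add]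

/-- **Coefficients of the relative Euler operator.** For `R = c₀·G − Σ_{i ≠ j} (y_i + b_i) ∂_i G`:
`coeff_β R = (c₀ − (|β| − β_j)) · coeff_β G − Σ_{i ≠ j} b_i (β_i + 1) · coeff_{β + e_i} G`. [folklore] -/
theorem coeff_eulerOperator (c₀ : K) (b : σ → K) (j : σ) (G : MvPolynomial σ K) (β : σ →₀ ℕ) :
    coeff β (C c₀ * G - ∑ i ∈ univ.erase j, (X i + C (b i)) * pderiv i G) =
      (c₀ - ((β.degree - β j : ℕ) : K)) * coeff β G
        - ∑ i ∈ univ.erase j, b i * (((β i : ℕ) : K) + 1) * coeff (β + Finsupp.single i 1) G := by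
  have hsum : ∑ i ∈ univ.erase j, (β i : K) = ((β.degree - β j : ℕ) : K) := by
    have h := degree_eq_add_sum_erase j β
    have h2 : ∑ i ∈ univ.erase j, β i = β.degree - β j := by omega
    rw [← h2, Nat.cast_sum]
  rw [coeff_sub, coeff_C_mul, coeff_sum]
  have hterm : ∀ i ∈ univ.erase j, coeff β ((X i + C (b i)) * pderiv i G) =
      (β i : K) * coeff β G + b i * (((β i : ℕ) : K) + 1) * coeff (β + Finsupp.single i 1) G := by
    intro i _
    rw [add_mul, coeff_add, coeff_X_mul_pderiv, coeff_C_mul, coeff_pderiv]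
    ring
  rw [Finset.sum_congr rfl hterm, Finset.sum_add_distrib, ← Finset.sum_mul, hsum]
  ring

/-- **Transfer.** A monomial `y^β` of `c₀·G − Σ_{i ≠ j} (y_i + b_i) ∂_i G` comes either from the
monomial `y^β` of `G` itself, with `c₀ ≠ |β| − β_j` in `K`, or from a monomial `y^{β + e_i}` of `G`
at a TRANSLATED index `i ≠ j` (`b_i ≠ 0`) whose `y_i`-exponent `β_i + 1` is non-zero in `K`.
[folklore] -/
theorem transfer_eulerOperator (c₀ : K) (b : σ → K) (j : σ) (G : MvPolynomial σ K) (β : σ →₀ ℕ)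
    (h : coeff β (C c₀ * G - ∑ i ∈ univ.erase j, (X i + C (b i)) * pderiv i G) ≠ 0) :
    (coeff β G ≠ 0 ∧ (c₀ - ((β.degree - β j : ℕ) : K)) ≠ 0) ∨
    (∃ i, i ≠ j ∧ b i ≠ 0 ∧ coeff (β + Finsupp.single i 1) G ≠ 0 ∧ (((β i : ℕ) : K) + 1) ≠ 0) := by
  rw [coeff_eulerOperator] at h
  by_contra hc
  push Not at hc
  obtain ⟨h1, h2⟩ := hc
  apply h
  have hfirst : (c₀ - ((β.degree - β j : ℕ) : K)) * coeff β G = 0 := by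
    by_cases hG : coeff β G = 0
    · rw [hG, mul_zero]
    · rw [h1 hG, zero_mul]
  have hsecond : ∑ i ∈ univ.erase j, b i * (((β i : ℕ) : K) + 1) * coeff (β + Finsupp.single i 1) G = 0 := by
    refine Finset.sum_eq_zero fun i hi => ?_
    have hij : i ≠ j := Finset.ne_of_mem_erase hi
    by_cases hbi : b i = 0
    · rw [hbi, zero_mul, zero_mul]
    by_cases hG : coeff (β + Finsupp.single i 1) G = 0
    · rw [hG, mul_zero]
    rw [h2 i hij hbi hG, mul_zero, zero_mul]
  rw [hfirst, hsecond, sub_zero]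

end Euler

/-! ## 2. Probe 3: the chart of a non-exceptional witness -/

section Main

variable {σ : Type*} {K : Type*} [Field K] [Fintype σ] [DecidableEq σ] [DecidableEq K]
variable (p : ℕ) [hp : Fact p.Prime] [CharP K p]

omit [Fintype σ] [DecidableEq K] hp [CharP K p] in
/-- **The `j`-weighted Euler probe is an operator applied to the translated chart transform.**
With `G = translate b (chartTransform q j F)` and any constant `c₀`,
`translate b (Σ_d (c₀ − |d| + d_j)·coeff_d F · y^{d^}) = c₀·G − Σ_{i ≠ j} (y_i + b_i) ∂G/∂y_i`
(`d^` the chart exponent): `Σ_{i ≠ j} y_i ∂_i` multiplies `y^{d^}` by `Σ_{i ≠ j} d^_i = |d| − d_j`,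
and `∂_i`, products and constants pass through the translation. [folklore] -/
theorem translate_eulerProbe [Fintype σ] (q : ℕ) (j : σ) (b : σ → K) (c₀ : K) (F : MvPolynomial σ K) :
    translate b (∑ d ∈ F.support,
        monomial (chartExponent q j d) ((c₀ - (d.degree : K) + (d j : K)) * coeff d F)) =
      C c₀ * translate b (chartTransform q j F)
        - ∑ i ∈ univ.erase j, (X i + C (b i)) * pderiv i (translate b (chartTransform q j F)) := by
  have hmono : ∀ d : σ →₀ ℕ,
      monomial (chartExponent q j d) ((c₀ - (d.degree : K) + (d j : K)) * coeff d F) =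
        C c₀ * monomial (chartExponent q j d) (coeff d F)
          - ∑ i ∈ univ.erase j, X i * pderiv i (monomial (chartExponent q j d) (coeff d F)) := by
    intro d
    rw [sum_erase_X_mul_pderiv_monomial, C_mul_monomial, ← map_sub]
    congr 1
    have h1 : (chartExponent q j d).degree - chartExponent q j d j = d.degree - d j := by
      rw [degree_chartExponent, chartExponent_apply, if_pos rfl, Nat.add_sub_cancel_left]
    rw [h1, Nat.cast_sub (Finsupp.le_degree j d)]
    ring
  unfold chartTransform
  rw [translate_finset_sum, translate_finset_sum]
  simp_rw [hmono, translate_sub, translate_C_mul, translate_finset_sum, translate_X_mul]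
  rw [Finset.sum_sub_distrib, Finset.mul_sum]
  congr 1
  rw [Finset.sum_comm]
  refine Finset.sum_congr rfl fun i _ => ?_
  rw [map_sum, Finset.mul_sum]
  refine Finset.sum_congr rfl fun d _ => ?_
  rw [pderiv_translate]

omit hp in
/-- **Probe 3 (the `j`-weighted Euler operator): the chart of a non-exceptional witness.**
Let `y_j` be NON-exceptional (`r_j = 0`) and suppose some initial monomial `y^{d₀}` of `F`
(`|d₀| = ord₀ F = o`) has `p ∤ (d₀)_j` (Moh's "`X`-kind" variable `x_s` carrying the term `A`
with `ord_{x_s} A = c`, `p ∤ c`, [Moh87] p. 972). Blow up the origin and pass to ANY point `b` of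
the `y_j`-chart (`b_j = 0`). Then the new residual polynomial has a monomial `y^E` in its lowest
`y_j`-layer (`E_j = o − p`), surviving the cleaning, with EITHER `|E| ≤ |r′| + shade − 1` (a strict
drop of the shade) OR `|E| ≤ |r′| + shade` and `p ∤ E_i` at some TRANSLATED index `i ≠ j`
(`b_i ≠ 0`, so `y_i` is non-exceptional in the new state). Mechanism: the probe polynomial
`P = Σ_d (o − |d| + d_j)·c_d·y^{d^}` has lowest `y_j`-layer spanned by the initial monomials with
`p ∤ d_j`, of degrees `≤ |ρ| + shade − 1` because `d_j ≥ 1 > 0 = r_j`; the layer lemma gives a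
low monomial `y^β` of `translate b P = o·G − Σ_{i ≠ j}(y_i + b_i) ∂G/∂y_i` (`translate_eulerProbe`),
and `transfer_eulerOperator` reads off a monomial of `G` at `β` (weight `o − Σ_{i≠j} β_i ≠ 0`
in `K`, so not a `p`-th power) or at `β + e_i` with `b_i ≠ 0`, `p ∤ β_i + 1`. Moh treats the
chart of `x_s` only WITHOUT translation (his Convention makes `x_s` the last variable; case "(1)
`v(x_s)` is the only minimal … the order of `F` will drop at least by `c`"); the translated
points of this chart are the new case. No cleanness or primality hypothesis is used.
[cite: Moh1987, §1 (p. 972, Statement (i)–(iii) and case (1))] -/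
theorem exists_support_step_of_not_dvd_self (j : σ) (b : σ → K) (hbj : b j = 0) (s : State σ K)
    {o : ℕ} (ho : ordZero s.F = o) (hpo : p ≤ o) (hr : ∀ d ∈ s.F.support, s.r ≤ d)
    (hrj : s.r j = 0) {d₀ : σ →₀ ℕ} (hd₀ : d₀ ∈ s.F.support) (hd₀deg : d₀.degree = o)
    (hd₀j : ¬ p ∣ d₀ j) :
    ∃ E ∈ (step p j b s).F.support, E j = o - p ∧
      (E.degree + 1 ≤ (step p j b s).r.degree + (o - s.r.degree) ∨
       (E.degree ≤ (step p j b s).r.degree + (o - s.r.degree) ∧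
        ∃ i, i ≠ j ∧ b i ≠ 0 ∧ ¬ p ∣ E i)) := by
  have hdeg := le_degree_of_ordZero_eq s ho
  -- `|r| + 1 ≤ o` (the witness exponent exceeds `r_j = 0`)
  have hd₀j1 : 1 ≤ d₀ j := by
    rcases Nat.eq_zero_or_pos (d₀ j) with h | h
    · rw [h] at hd₀j; exact (hd₀j (dvd_zero p)).elim
    · exact h
  have hro : s.r.degree + 1 ≤ o := by
    have hne : s.r ≠ d₀ := by
      intro h; rw [← h, hrj] at hd₀j1; exact absurd hd₀j1 (by omega)
    have := degree_lt_degree_of_lt (lt_of_le_of_ne (hr d₀ hd₀) hne)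
    omega
  set ρ : σ →₀ ℕ := s.r.update j (o - p) with hρdef
  have hρj : ρ j = o - p := by rw [hρdef, Finsupp.update_apply, if_pos rfl]
  have hρi : ∀ i, i ≠ j → ρ i = s.r i := fun i hi => by
    rw [hρdef, Finsupp.update_apply, if_neg hi]
  have hρdeg : ρ.degree = s.r.degree + (o - p) := by
    have := degree_update_add s.r j (o - p)
    rw [← hρdef, hrj] at this
    omega
  -- the probe polynomial
  set g : (σ →₀ ℕ) → K := fun d => ((o : K) - (d.degree : K) + (d j : K)) * coeff d s.F with hgdef
  set Po : MvPolynomial σ K := ∑ d ∈ s.F.support, monomial (chartExponent p j d) (g d) with hPo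
  have hsuppPo : ∀ e ∈ Po.support, ∃ d ∈ s.F.support, g d ≠ 0 ∧ chartExponent p j d = e :=
    fun e he => exists_of_mem_support_sum_monomial _ _ _ he
  have hρle : ∀ e ∈ Po.support, ρ ≤ e := by
    intro e he
    obtain ⟨d, hd, -, rfl⟩ := hsuppPo e he
    rw [Finsupp.le_def]
    intro i
    rw [chartExponent_apply]
    by_cases hij : i = j
    · subst hij
      rw [if_pos rfl, hρj]
      have := hdeg d hd
      omega
    · rw [if_neg hij, hρi i hij]
      exact Finsupp.le_def.mp (hr d hd) i
  -- on the lowest layer the weight is `d_j`, non-zero only if `p ∤ d_j`, whence `d_j ≥ 1`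
  have hlow : ∀ d ∈ s.F.support, g d ≠ 0 → d.degree = o → 1 ≤ d j := by
    intro d _ hgd hdo
    rcases Nat.eq_zero_or_pos (d j) with h | h
    · exfalso; apply hgd
      rw [hgdef]
      simp only [hdo, h, Nat.cast_zero, sub_self, zero_add, zero_mul]
    · exact h
  have hD : ∀ e ∈ Po.support, e j = ρ j → e.degree ≤ ρ.degree + (o - s.r.degree - 1) := by
    intro e he hej
    obtain ⟨d, hd, hgd, rfl⟩ := hsuppPo e he
    rw [chartExponent_apply, if_pos rfl, hρj] at hej
    have h1 := hdeg d hd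
    have h2 : d.degree = o := by omega
    have h3 := hlow d hd hgd h2
    rw [degree_chartExponent, h2, hρdeg]
    omega
  have hgd₀ : g d₀ ≠ 0 := by
    rw [hgdef]
    refine mul_ne_zero ?_ (MvPolynomial.mem_support_iff.mp hd₀)
    rw [hd₀deg, sub_self, zero_add, Ne, CharP.cast_eq_zero_iff K p]
    exact hd₀j
  have hlayer : ∃ e ∈ Po.support, e j = ρ j := by
    refine ⟨chartExponent p j d₀, ?_, ?_⟩
    · rw [MvPolynomial.mem_support_iff, hPo,
        coeff_sum_monomial_of_injOn s.F.support (chartExponent p j) g hd₀]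
      · exact hgd₀
      · intro d hd _ h
        exact chartExponent_injective (le_trans hpo (hdeg d hd)) (le_trans hpo (hdeg d₀ hd₀)) h
    · rw [chartExponent_apply, if_pos rfl, hd₀deg, hρj]
  obtain ⟨β, hβ, hβj, hβdeg⟩ :=
    exists_mem_support_translate_layer b hbj Po ρ hρle (o - s.r.degree - 1) hD hlayer
  -- the new multiplicities are `ρ` filtered
  have hr1 : (step p j b s).r = ρ.filter (fun i => b i = 0) := by
    show newMult p j b s = _
    rw [newMult_eq p j b hbj s ho, hρdef]
  -- read `β` through the operator identity
  set G : MvPolynomial σ K := pointTransform p j b s with hGdef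
  have hident : translate b Po =
      C (o : K) * G - ∑ i ∈ univ.erase j, (X i + C (b i)) * pderiv i G := by
    rw [hPo, hGdef]
    unfold pointTransform
    exact translate_eulerProbe p j b (o : K) s.F
  have hβcoeff : coeff β (C (o : K) * G - ∑ i ∈ univ.erase j, (X i + C (b i)) * pderiv i G) ≠ 0 := by
    rw [← hident]; exact MvPolynomial.mem_support_iff.mp hβ
  rcases transfer_eulerOperator (o : K) b j G β hβcoeff with ⟨hβG, hwt⟩ | ⟨i, hij, hbi, hiG, hcast⟩
  · -- Case A: `y^β` itself is a monomial of `G`, of weight `o − Σ_{i ≠ j} β_i ≠ 0`: a strict drop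
    have hnot : ¬ IsPthPowerExponent p β := by
      intro hP
      have hall := (isPthPowerExponent_iff p β).mp hP
      apply hwt
      have hpo' : p ∣ o := by
        have h1 : p ∣ β j := hall j
        rw [hβj, hρj] at h1
        have : o = (o - p) + p := by omega
        rw [this]
        exact dvd_add h1 (dvd_refl p)
      have hsum : p ∣ β.degree - β j := by
        have h := degree_eq_add_sum_erase j β
        have h2 : β.degree - β j = ∑ i ∈ univ.erase j, β i := by omega
        rw [h2]
        exact Finset.dvd_sum fun i _ => hall i
      rw [(CharP.cast_eq_zero_iff K p o).mpr hpo', (CharP.cast_eq_zero_iff K p _).mpr hsum, sub_zero]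
    refine ⟨β, ?_, by rw [hβj, hρj], Or.inl ?_⟩
    · show β ∈ (deletePthPowers p (pointTransform p j b s)).support
      rw [MvPolynomial.mem_support_iff, coeff_deletePthPowers, if_neg hnot]
      exact hβG
    · rw [hr1]
      omega
  · -- Case B: `y^{β + e_i}` is a monomial of `G` with `b_i ≠ 0` and `p ∤ β_i + 1`
    set E : σ →₀ ℕ := β + Finsupp.single i 1 with hEdef
    have hEi : E i = β i + 1 := by
      rw [hEdef, Finsupp.add_apply, Finsupp.single_eq_same]
    have hnoti : ¬ p ∣ E i := by
      intro h1
      rw [hEi, ← CharP.cast_eq_zero_iff K p, Nat.cast_succ] at h1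
      exact hcast h1
    have hnot : ¬ IsPthPowerExponent p E := fun h =>
      hnoti ((isPthPowerExponent_iff p E).mp h i)
    have hEj : E j = o - p := by
      rw [hEdef, Finsupp.add_apply, Finsupp.single_apply, if_neg hij, add_zero, hβj, hρj]
    refine ⟨E, ?_, hEj, Or.inr ⟨?_, i, hij, hbi, hnoti⟩⟩
    · show E ∈ (deletePthPowers p (pointTransform p j b s)).support
      rw [MvPolynomial.mem_support_iff, coeff_deletePthPowers, if_neg hnot]
      exact hiG
    · have hEdeg : E.degree = β.degree + 1 := by
        rw [hEdef, map_add, Finsupp.degree_single]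
      rw [hEdeg, hr1]
      omega


/-! ## 3. Moh's witness: no increase in ANY chart, and persistence under a stall -/

omit hp in
/-- **No increase in the chart of a non-exceptional witness** (new case relative to [Moh87], where
the chart of `x_s` is taken only without translation): if `r_j = 0` and an initial monomial of
`F` has `p ∤ d_j`, the shade does not increase at any point of the `y_j`-chart.
[cite: Moh1987, §1 (p. 972, cases (1)–(2))] -/
theorem shade_step_le_of_not_dvd_self (j : σ) (b : σ → K) (hbj : b j = 0) (s : State σ K)
    {o : ℕ} (ho : ordZero s.F = o) (hpo : p ≤ o) (hr : ∀ d ∈ s.F.support, s.r ≤ d)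
    (hrj : s.r j = 0) {d₀ : σ →₀ ℕ} (hd₀ : d₀ ∈ s.F.support) (hd₀deg : d₀.degree = o)
    (hd₀j : ¬ p ∣ d₀ j) : (step p j b s).shade ≤ s.shade := by
  obtain ⟨E, hE, -, hcases⟩ :=
    exists_support_step_of_not_dvd_self p j b hbj s ho hpo hr hrj hd₀ hd₀deg hd₀j
  rw [shade_eq_of_ordZero_eq s ho]
  refine shade_le_of_mem_support _ hE ?_
  rcases hcases with h | ⟨h, -⟩
  · omega
  · exact h

omit hp [CharP K p] in
/-- **Moh's case (1): at the ORIGIN of the chart of the witness the shade drops by at least the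
witness exponent.** If `r_j = 0`, `y^{d₀}` is an initial monomial of `F` with `p ∤ c := (d₀)_j`, and
the point is the origin of the `y_j`-chart (no translation: `b = 0`), then
`shade′ + c ≤ shade` — "In the first case, we have to factor out `x_s` and do it without any
translation. Due to the existence of the term `A`, the order of `F` will drop at least by `c`"
([Moh87] p. 972). Indeed the chart image `y^{d₀^}` of `y^{d₀}` is a monomial of the new residual
polynomial (no cancellation without translation; not a `p`-th power since `p ∤ c` and, if
`p ∣ o`, `p ∤ Σ_{i ≠ j} (d₀)_i`) of degree `(o − p) + (o − c) = |r′| + shade − c`.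
[cite: Moh1987, §1 (p. 972, case (1))] -/
theorem shade_step_add_le_of_untranslated (j : σ) (b : σ → K) (hb0 : ∀ i, b i = 0)
    (s : State σ K) {o : ℕ} (ho : ordZero s.F = o) (hpo : p ≤ o)
    (hr : ∀ d ∈ s.F.support, s.r ≤ d) (hrj : s.r j = 0) {d₀ : σ →₀ ℕ} (hd₀ : d₀ ∈ s.F.support)
    (hd₀deg : d₀.degree = o) (hd₀j : ¬ p ∣ d₀ j) :
    (step p j b s).shade + (d₀ j : ℕ∞) ≤ s.shade := by
  have hdeg := le_degree_of_ordZero_eq s ho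
  set E : σ →₀ ℕ := chartExponent p j d₀ with hEdef
  have hEj : E j = o - p := by rw [hEdef, chartExponent_apply, if_pos rfl, hd₀deg]
  have hEi : ∀ i, i ≠ j → E i = d₀ i := fun i hi => by
    rw [hEdef, chartExponent_apply, if_neg hi]
  -- `y^E` is a monomial of the untranslated chart transform
  have hEG : coeff E (pointTransform p j b s) ≠ 0 := by
    unfold pointTransform
    rw [translate_eq_self b hb0]
    unfold chartTransform
    rw [hEdef, coeff_sum_monomial_of_injOn s.F.support (chartExponent p j) (fun d => coeff d s.F) hd₀]
    · exact MvPolynomial.mem_support_iff.mp hd₀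
    · intro d hd _ h
      exact chartExponent_injective (le_trans hpo (hdeg d hd)) (le_trans hpo (hdeg d₀ hd₀)) h
  -- and not a `p`-th power
  have hnot : ¬ IsPthPowerExponent p E := by
    intro hP
    have hall := (isPthPowerExponent_iff p E).mp hP
    apply hd₀j
    have hpo' : p ∣ o := by
      have h1 : p ∣ E j := hall j
      rw [hEj] at h1
      have : o = (o - p) + p := by omega
      rw [this]
      exact dvd_add h1 (dvd_refl p)
    have hsum : p ∣ ∑ i ∈ univ.erase j, d₀ i := by
      refine Finset.dvd_sum fun i hi => ?_
      rw [← hEi i (Finset.ne_of_mem_erase hi)]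
      exact hall i
    have htot : p ∣ d₀ j + ∑ i ∈ univ.erase j, d₀ i := by
      rw [← degree_eq_add_sum_erase j d₀, hd₀deg]; exact hpo'
    exact (Nat.dvd_add_left hsum).mp htot
  have hE : E ∈ (step p j b s).F.support := by
    show E ∈ (deletePthPowers p (pointTransform p j b s)).support
    rw [MvPolynomial.mem_support_iff, coeff_deletePthPowers, if_neg hnot]
    exact hEG
  -- degree bookkeeping: `|E| = (o − p) + (o − c)`, `|r′| = |r| + (o − p)`, `|r| + c ≤ o`
  have hEdeg : E.degree = (o - p) + (o - d₀ j) := by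
    rw [hEdef, degree_chartExponent, hd₀deg]
  have hr1 : (step p j b s).r = s.r.update j (o - p) := by
    show newMult p j b s = _
    rw [newMult_eq p j b (hb0 j) s ho]
    ext i
    rw [Finsupp.filter_apply, if_pos (hb0 i)]
  have hr1deg : (step p j b s).r.degree = s.r.degree + (o - p) := by
    have := degree_update_add s.r j (o - p)
    rw [← hr1, hrj] at this
    omega
  have hrc : s.r.degree + d₀ j ≤ o := by
    rw [degree_eq_add_sum_erase j s.r, hrj, ← hd₀deg, degree_eq_add_sum_erase j d₀]
    have : ∑ i ∈ univ.erase j, s.r i ≤ ∑ i ∈ univ.erase j, d₀ i :=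
      Finset.sum_le_sum fun i _ => Finsupp.le_def.mp (hr d₀ hd₀) i
    omega
  have hbound : (step p j b s).shade ≤ ((o - s.r.degree - d₀ j : ℕ) : ℕ∞) :=
    shade_le_of_mem_support _ hE (by rw [hEdeg, hr1deg]; omega)
  rw [shade_eq_of_ordZero_eq s ho]
  calc (step p j b s).shade + (d₀ j : ℕ∞)
      ≤ ((o - s.r.degree - d₀ j : ℕ) : ℕ∞) + (d₀ j : ℕ∞) := add_le_add hbound le_rfl
    _ = ((o - s.r.degree - d₀ j + d₀ j : ℕ) : ℕ∞) := by push_cast; rfl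
    _ ≤ ((o - s.r.degree : ℕ) : ℕ∞) := by exact_mod_cast (by omega)

/-- **Moh's witness forbids an increase, in every chart and every dimension.** If some
NON-exceptional variable `y_{i₀}` (`r_{i₀} = 0`) occurs in an initial monomial of the cleaned
residual polynomial `F` with an exponent prime to `p` — Moh's situation after an increase: "now
`x_s` is an `X`-kind of variable", `F` "has a term `A` with … `ord_{x_s} A = c` … `p ∤ c`"
([Moh87] p. 972) — then NO point blow-up (any chart `y_j`, any point `b` of its exceptional
divisor) increases the shade: the chart `j ≠ i₀` is Probe 2 (`shade_step_le_of_not_dvd_apply`,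
Moh's case (2)), the chart `j = i₀` is Probe 3 (`shade_step_le_of_not_dvd_self`; Moh's case (1)
extended to translated points). [cite: Moh1987, §1 (p. 972, cases (1)–(2))] -/
theorem shade_step_le_of_witness (j : σ) (b : σ → K) (hbj : b j = 0) (s : State σ K)
    {o : ℕ} (ho : ordZero s.F = o) (hpo : p ≤ o) (hr : ∀ d ∈ s.F.support, s.r ≤ d)
    {i₀ : σ} (hri₀ : s.r i₀ = 0) {d₀ : σ →₀ ℕ} (hd₀ : d₀ ∈ s.F.support) (hd₀deg : d₀.degree = o)
    (hd₀i : ¬ p ∣ d₀ i₀) : (step p j b s).shade ≤ s.shade := by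
  by_cases h : i₀ = j
  · subst h
    exact shade_step_le_of_not_dvd_self p i₀ b hbj s ho hpo hr hri₀ hd₀ hd₀deg hd₀i
  · exact shade_step_le_of_not_dvd_apply p j b hbj s ho hpo hr h (Or.inr hri₀) hd₀ hd₀deg hd₀i

/-- The same, as a statement about the atlas predicate: a state with Moh's witness has NO
kangaroo point above it in any chart (`¬ ShadeIncreases`). [cite: Moh1987, §1 (p. 972)] -/
theorem not_shadeIncreases_of_witness (j : σ) (b : σ → K) (hbj : b j = 0) (s : State σ K)
    {o : ℕ} (ho : ordZero s.F = o) (hpo : p ≤ o) (hr : ∀ d ∈ s.F.support, s.r ≤ d)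
    {i₀ : σ} (hri₀ : s.r i₀ = 0) {d₀ : σ →₀ ℕ} (hd₀ : d₀ ∈ s.F.support) (hd₀deg : d₀.degree = o)
    (hd₀i : ¬ p ∣ d₀ i₀) : ¬ ShadeIncreases p j b s := by
  unfold ShadeIncreases
  exact not_lt.mpr (shade_step_le_of_witness p j b hbj s ho hpo hr hri₀ hd₀ hd₀deg hd₀i)

omit [DecidableEq σ] [DecidableEq K] hp [CharP K p] in
/-- Degree bookkeeping for a stall: a monomial of degree `≤ |r′| + A` of a state of shade `A`
(whose exceptional monomial divides it) is an initial monomial. [folklore] -/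
theorem degree_eq_of_shade_eq (t : State σ K) {o' : ℕ} (ho' : ordZero t.F = o')
    (hr' : ∀ E ∈ t.F.support, t.r ≤ E) {E : σ →₀ ℕ} (hE : E ∈ t.F.support) {A : ℕ}
    (hEA : E.degree ≤ t.r.degree + A) (hshade : t.shade = (A : ℕ∞)) : E.degree = o' := by
  have h1 : o' ≤ E.degree := by
    have := ordZero_le_of_coeff_ne_zero _ _ (MvPolynomial.mem_support_iff.mp hE)
    rw [ho'] at this
    exact_mod_cast this
  obtain ⟨⟨E₁, hE₁, hE₁deg⟩, -⟩ := (ordZero_eq_nat_iff _ _).mp ho'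
  have h2 : t.r.degree ≤ o' :=
    hE₁deg ▸ degree_le_degree_of_le (hr' E₁ (MvPolynomial.mem_support_iff.mpr hE₁))
  rw [shade_eq_of_ordZero_eq t ho'] at hshade
  have h3 : o' - t.r.degree = A := by exact_mod_cast hshade
  omega

/-- **Persistence of Moh's witness under a stall, in every dimension.** In the situation of
`shade_step_le_of_witness`, if the shade of the new state EQUALS the old one (a stall), the new
state again has a non-exceptional variable occurring in an initial monomial with an exponent
prime to `p`: in a chart `j ≠ i₀` the variable `y_{i₀}` itself (the monomial of Probe 2 has
degree `≤ |r′| + shade`, hence is initial), in the chart `j = i₀` a translated variable `y_i`,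
`b_i ≠ 0` (Probe 3: the strict-drop alternative is excluded by the stall). Derived here; the
printed precursor is Moh's remark that in case (2) "the order of `F` will not increase" with the
term `A` kept ([Moh87] p. 972–973, "Repeating the above argument").
[cite: Moh1987, §1 (p. 972–973)] -/
theorem exists_witness_step_of_shade_eq (j : σ) (b : σ → K) (hbj : b j = 0) (s : State σ K)
    {o : ℕ} (ho : ordZero s.F = o) (hpo : p ≤ o) (hr : ∀ d ∈ s.F.support, s.r ≤ d)
    {i₀ : σ} (hri₀ : s.r i₀ = 0) {d₀ : σ →₀ ℕ} (hd₀ : d₀ ∈ s.F.support) (hd₀deg : d₀.degree = o)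
    (hd₀i : ¬ p ∣ d₀ i₀) (hstall : (step p j b s).shade = s.shade) :
    ∃ (i₁ : σ) (o₁ : ℕ) (E : σ →₀ ℕ), ordZero (step p j b s).F = o₁ ∧ E ∈ (step p j b s).F.support ∧
      E.degree = o₁ ∧ ¬ p ∣ E i₁ ∧ (step p j b s).r i₁ = 0 := by
  have hr1 := newMult_le_of_mem_support_step p j b hbj s ho hr
  have hro : s.r.degree + 1 ≤ o := by
    have hne : s.r ≠ d₀ := by
      intro h; rw [← h, hri₀] at hd₀i; exact hd₀i (dvd_zero p)
    have := degree_lt_degree_of_lt (lt_of_le_of_ne (hr d₀ hd₀) hne)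
    omega
  have hshade1 : (step p j b s).shade = ((o - s.r.degree : ℕ) : ℕ∞) := by
    rw [hstall, shade_eq_of_ordZero_eq s ho]
  -- a natural-number order for the new state (it has a monomial by the probes)
  have hord1 : ∀ {E : σ →₀ ℕ}, E ∈ (step p j b s).F.support →
      ∃ o₁ : ℕ, ordZero (step p j b s).F = o₁ := by
    intro E hE
    have hF1 : (step p j b s).F ≠ 0 := fun h => by
      rw [h, MvPolynomial.support_zero] at hE; exact Finset.notMem_empty _ hE
    have hne : ordZero (step p j b s).F ≠ ⊤ := by
      unfold ordZero
      rw [Ne, MvPowerSeries.order_eq_top_iff, MvPolynomial.coe_eq_zero_iff]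
      exact hF1
    obtain ⟨o₁, ho₁'⟩ := WithTop.ne_top_iff_exists.mp hne
    exact ⟨o₁, ho₁'.symm⟩
  by_cases h : i₀ = j
  · subst h
    obtain ⟨E, hE, -, hcases⟩ :=
      exists_support_step_of_not_dvd_self p i₀ b hbj s ho hpo hr hri₀ hd₀ hd₀deg hd₀i
    obtain ⟨o₁, ho₁⟩ := hord1 hE
    rcases hcases with hlt | ⟨hle, i, hij, hbi, hEi⟩
    · -- a strict drop contradicts the stall
      exfalso
      have h1 := degree_eq_of_shade_eq (step p i₀ b s) ho₁ hr1 hE (A := o - s.r.degree) (by omega)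
        hshade1
      obtain ⟨⟨E₁, hE₁, hE₁deg⟩, -⟩ := (ordZero_eq_nat_iff _ _).mp ho₁
      have h2 : (step p i₀ b s).r.degree ≤ o₁ :=
        hE₁deg ▸ degree_le_degree_of_le (hr1 E₁ (MvPolynomial.mem_support_iff.mpr hE₁))
      rw [shade_eq_of_ordZero_eq _ ho₁] at hshade1
      have h3 : o₁ - (step p i₀ b s).r.degree = o - s.r.degree := by exact_mod_cast hshade1
      omega
    · refine ⟨i, o₁, E, ho₁, hE, ?_, hEi, ?_⟩
      · exact degree_eq_of_shade_eq (step p i₀ b s) ho₁ hr1 hE hle hshade1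
      · show newMult p i₀ b s i = 0
        rw [newMult_eq p i₀ b hbj s ho, Finsupp.filter_apply, if_neg hbi]
  · obtain ⟨E, hE, hEi₀, -, hEdeg⟩ :=
      exists_support_step_of_not_dvd_apply' p j b hbj s ho hpo hr h hd₀ hd₀deg hd₀i
    rw [probe_bound_of_apply_eq_zero j b hbj s ho hri₀ hro] at hEdeg
    obtain ⟨o₁, ho₁⟩ := hord1 hE
    refine ⟨i₀, o₁, E, ho₁, hE, ?_, hEi₀, ?_⟩
    · exact degree_eq_of_shade_eq (step p j b s) ho₁ hr1 hE hEdeg hshade1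
    · show newMult p j b s i₀ = 0
      rw [newMult_eq p j b hbj s ho, Finsupp.filter_apply, Finsupp.update_apply, if_neg h, hri₀]
      split_ifs <;> rfl


/-! ## 4. Moh's stability theorem along sequences of point blow-ups -/

/-- **Moh's Stability Theorem at order `p` (`e = 1`), in every dimension, for point blow-ups at
arbitrary points.** Start from a cleaned state (`F ≠ 0`, no `p`-th power monomials, `y^r ∣ F`)
and follow ANY sequence of point blow-ups — step `n` blows up the origin, passes to an arbitrary
point `b n` of the exceptional divisor read in an arbitrary chart `y_{j n}` (`b n (j n) = 0`),
and cleans — along which the order stays `≥ p` (the equimultiple branch). Then for all `n ≤ m`: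
`shade(s_m) ≤ shade(s_n) + 1`. Equivalently: the shade never exceeds its running minimum by
more than one; after an increase `d ↦ d + 1` it does not increase again before it has returned
to `≤ d` (`shade_eq_add_one_until_drop`). This is Moh's "successive permissible blow-ups will not
increase `ord F̄` beyond the bound `d + p^{e−1}` … until it drops to `d` or less" ([Moh87],
Introduction p. 966 and §1 p. 972–973) for `e = 1`, with Moh's valuation-guided choice of centre
and chart ("Convention", p. 967) replaced by free choices of closed points in all charts;
Hauser–Perlega: "it is known to be valid for `e = 1`" ([HP19], §3); Hauser: "in the next blowup
the shade has to drop at least by 1 (if `e = 1`). This, obviously, does not suffice yet to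
make induction work" ([Ha10] p. 16) — point-wise the sharp statement is "does not increase"
(stalls occur: `PointBlowupKangaroo.shadeStalls_kangaroo_origin`). Proof: the invariant "Moh's
witness" (a non-exceptional variable with an initial exponent prime to `p`) is created by an
increase (`exists_nonexceptional_of_shadeIncreases`), forbids a further increase in every chart
(`shade_step_le_of_witness`) and survives stalls (`exists_witness_step_of_shade_eq`). For
`e ≥ 3` the analogous statement is FALSE (`Literature.Barriers.….mohStabilityClaim_false`,
[HP19]); `e = 2` is not treated. [cite: Moh1987, Stability Theorem (Introduction) and §1]
[cite: HauserPerlega2019, §3] [cite: Hauser2010, §F (p. 16)] -/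
theorem shade_le_shade_add_one_along (s : ℕ → State σ K) (j : ℕ → σ) (b : ℕ → σ → K)
    (hb : ∀ n, b n (j n) = 0) (hstep : ∀ n, s (n + 1) = step p (j n) (b n) (s n))
    (hF0 : (s 0).F ≠ 0) (hclean : deletePthPowers p (s 0).F = (s 0).F)
    (hr : ∀ d ∈ (s 0).F.support, (s 0).r ≤ d) (hord : ∀ n, (p : ℕ∞) ≤ ordZero (s n).F)
    {n m : ℕ} (hnm : n ≤ m) : (s m).shade ≤ (s n).shade + 1 := by
  -- invariants along the sequence: non-zero, cleaned, divisible by the exceptional monomial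
  have hinv : ∀ n, (s n).F ≠ 0 ∧ deletePthPowers p (s n).F = (s n).F ∧
      ∀ d ∈ (s n).F.support, (s n).r ≤ d := by
    intro n
    induction n with
    | zero => exact ⟨hF0, hclean, hr⟩
    | succ n ih =>
      obtain ⟨ih0, ih1, ih2⟩ := ih
      have hne : ordZero (s n).F ≠ ⊤ := by
        unfold ordZero
        rw [Ne, MvPowerSeries.order_eq_top_iff, MvPolynomial.coe_eq_zero_iff]
        exact ih0
      obtain ⟨o, ho'⟩ := WithTop.ne_top_iff_exists.mp hne
      have ho : ordZero (s n).F = o := ho'.symm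
      have hpo : p ≤ o := by
        have := hord n
        rw [ho] at this
        exact_mod_cast this
      rw [hstep n]
      exact ⟨step_F_ne_zero p (j n) (b n) (hb n) (s n) ih1 ho hpo ih2,
        deletePthPowers_step p (j n) (b n) (s n),
        newMult_le_of_mem_support_step p (j n) (b n) (hb n) (s n) ho ih2⟩
  -- natural-number orders
  have hnat : ∀ n, ∃ o : ℕ, ordZero (s n).F = o ∧ p ≤ o := by
    intro n
    obtain ⟨h0, -, -⟩ := hinv n
    have hne : ordZero (s n).F ≠ ⊤ := by
      unfold ordZero
      rw [Ne, MvPowerSeries.order_eq_top_iff, MvPolynomial.coe_eq_zero_iff]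
      exact h0
    obtain ⟨o, ho'⟩ := WithTop.ne_top_iff_exists.mp hne
    have ho : ordZero (s n).F = o := ho'.symm
    refine ⟨o, ho, ?_⟩
    have := hord n
    rw [ho] at this
    exact_mod_cast this
  -- the witness predicate
  let W : State σ K → Prop := fun t =>
    ∃ (i : σ) (o : ℕ) (E : σ →₀ ℕ), ordZero t.F = o ∧ E ∈ t.F.support ∧ E.degree = o ∧
      ¬ p ∣ E i ∧ t.r i = 0
  obtain ⟨a, ha, -⟩ := hnat n
  have hshade_n : (s n).shade = ((a - (s n).r.degree : ℕ) : ℕ∞) := shade_eq_of_ordZero_eq _ ha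
  -- induction on `m = n + k`
  obtain ⟨k, rfl⟩ := Nat.exists_eq_add_of_le hnm
  clear hnm
  suffices hk : (s (n + k)).shade ≤ (s n).shade + 1 ∧
      ((s (n + k)).shade = (s n).shade + 1 → W (s (n + k))) from hk.1
  induction k with
  | zero =>
    refine ⟨le_self_add, fun h => ?_⟩
    exfalso
    rw [Nat.add_zero, hshade_n] at h
    have : (a - (s n).r.degree : ℕ) = (a - (s n).r.degree) + 1 := by exact_mod_cast h
    omega
  | succ k ih =>
    obtain ⟨ih1, ih2⟩ := ih
    obtain ⟨-, hcl, hrk⟩ := hinv (n + k)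
    obtain ⟨o, ho, hpo⟩ := hnat (n + k)
    have hstepk : s (n + (k + 1)) = step p (j (n + k)) (b (n + k)) (s (n + k)) := by
      rw [← Nat.add_assoc]; exact hstep (n + k)
    have hshade_k : (s (n + k)).shade = ((o - (s (n + k)).r.degree : ℕ) : ℕ∞) :=
      shade_eq_of_ordZero_eq _ ho
    by_cases htop : (s (n + k)).shade = (s n).shade + 1
    · -- at the top: the witness forbids an increase and survives a stall
      obtain ⟨i₀, o', E, ho', hE, hEdeg, hEi, hri⟩ := ih2 htop
      have hoo : o' = o := by
        have := ho'.symm.trans ho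
        exact_mod_cast this
      subst hoo
      have hle := shade_step_le_of_witness p (j (n + k)) (b (n + k)) (hb (n + k)) (s (n + k)) ho'
        hpo hrk hri hE hEdeg hEi
      rw [← hstepk] at hle
      refine ⟨le_trans hle (le_of_eq htop), fun heq => ?_⟩
      have hstall : (step p (j (n + k)) (b (n + k)) (s (n + k))).shade = (s (n + k)).shade := by
        rw [← hstepk, heq, htop]
      obtain ⟨i₁, o₁, E₁, ho₁, hE₁, hE₁deg, hE₁i, hr₁⟩ :=
        exists_witness_step_of_shade_eq p (j (n + k)) (b (n + k)) (hb (n + k)) (s (n + k)) ho' hpo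
          hrk hri hE hEdeg hEi hstall
      rw [← hstepk] at ho₁ hE₁ hr₁
      exact ⟨i₁, o₁, E₁, ho₁, hE₁, hE₁deg, hE₁i, hr₁⟩
    · -- below the top: Moh's one-step bound, and an increase creates the witness
      have hlt : (s (n + k)).shade < (s n).shade + 1 := lt_of_le_of_ne ih1 htop
      have hle : (s (n + k)).shade ≤ (s n).shade := by
        rw [hshade_k, hshade_n] at hlt ⊢
        have : (o - (s (n + k)).r.degree : ℕ) < (a - (s n).r.degree) + 1 := by exact_mod_cast hlt
        exact_mod_cast (by omega : (o - (s (n + k)).r.degree : ℕ) ≤ (a - (s n).r.degree))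
      have hM := shade_succ_le_along p s j b hb hstep hclean hr hord (n + k)
      refine ⟨le_trans hM (add_le_add hle le_rfl), fun heq => ?_⟩
      have hinc : ShadeIncreases p (j (n + k)) (b (n + k)) (s (n + k)) := by
        unfold ShadeIncreases
        rw [← hstepk, heq]
        exact lt_of_le_of_lt hle (by
          rw [hshade_n]
          exact_mod_cast (by omega : (a - (s n).r.degree : ℕ) < (a - (s n).r.degree) + 1))
      obtain ⟨i₀, -, -, -, hr1i₀, o₁, ho₁, -, E, hE, hEdeg, hEi₀, -⟩ :=
        exists_nonexceptional_of_shadeIncreases p (j (n + k)) (b (n + k)) (hb (n + k)) (s (n + k))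
          hcl ho hpo hrk hinc
      rw [← hstepk] at hr1i₀ ho₁ hE
      exact ⟨i₀, o₁, E, ho₁, hE, hEdeg, hEi₀, hr1i₀⟩

/-- **The shade never exceeds its initial value by more than one** (the case `n = 0`).
[cite: Moh1987, Stability Theorem (Introduction)] -/
theorem shade_le_shade_zero_add_one_along (s : ℕ → State σ K) (j : ℕ → σ) (b : ℕ → σ → K)
    (hb : ∀ n, b n (j n) = 0) (hstep : ∀ n, s (n + 1) = step p (j n) (b n) (s n))
    (hF0 : (s 0).F ≠ 0) (hclean : deletePthPowers p (s 0).F = (s 0).F)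
    (hr : ∀ d ∈ (s 0).F.support, (s 0).r ≤ d) (hord : ∀ n, (p : ℕ∞) ≤ ordZero (s n).F)
    (m : ℕ) : (s m).shade ≤ (s 0).shade + 1 :=
  shade_le_shade_add_one_along p s j b hb hstep hF0 hclean hr hord (Nat.zero_le m)

/-- **Moh's phrasing: after an increase the shade stays at `d + 1` until it drops to `≤ d`.**
If the shade increases at step `n` (from `d = shade(s_n)`), then at every later time `m` before
which it has not returned to `≤ d` it EQUALS `d + 1`. [cite: Moh1987, Stability Theorem
("will not increase ord F̄ beyond the bound d + p^{e-1} … until it drops to d or less")] -/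
theorem shade_eq_add_one_until_drop (s : ℕ → State σ K) (j : ℕ → σ) (b : ℕ → σ → K)
    (hb : ∀ n, b n (j n) = 0) (hstep : ∀ n, s (n + 1) = step p (j n) (b n) (s n))
    (hF0 : (s 0).F ≠ 0) (hclean : deletePthPowers p (s 0).F = (s 0).F)
    (hr : ∀ d ∈ (s 0).F.support, (s 0).r ≤ d) (hord : ∀ n, (p : ℕ∞) ≤ ordZero (s n).F)
    {n m : ℕ} (hnm : n ≤ m) (hnodrop : (s n).shade < (s m).shade) :
    (s m).shade = (s n).shade + 1 := by
  refine le_antisymm (shade_le_shade_add_one_along p s j b hb hstep hF0 hclean hr hord hnm) ?_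
  exact Order.add_one_le_of_lt hnodrop


end Main


end PointBlowup

end Literature.AlgebraicGeometry.Resolution
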